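import Summits.Ventures.PercRepro.PuncturedLYMSteiner

/-!
# PercRepro — (SP) FOR `j = 2`: EVERY MATCHING CODE HAS THE PUNCTURED NORMALISED MATCHING PROPERTY
(p10, gen 30; continues PuncturedLYM / PuncturedLYMSteiner)

A code of `2`-sets is a MATCHING `D` (pairwise disjoint pairs); `P` = the non-matching pairs, `Y` = the triples.  Points are
MATCHED (`matchedPts D`, `2m` of them, `m = #D`) or UNMATCHED (`u = n − 2m`); a pair `X ∈ P` has `k = #(X ∩ M) ∈ {0,1,2}`
matched points; a triple is touched iff it contains a matching edge.

THIS FILE (the objects and the row sums; the column sums are PuncturedLYMMatchingCols, the theorem itself is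
PuncturedLYMMatchingMain): `matchedPts`, `kOf` (`k(X) = #(X ∩ M)`), `card_codeNbrs_two` / `touchedCount_two`
(`t(X) = k(X)` for `X ∈ P`), `rr` (`= #Y/#P`) with `rr_mul` (its closed form `r · 3(n(n−1) − 2m) = n(n−1)(n−2)`), the
weights `a0`, `b2`, `aW`, `bW`, `omW`, `mW`, and `sum_sups_mW` (the row sum at a pair with `k` matched points).  **THEOREM `puncturedNMP_of_matching` (PuncturedLYMMatchingMain): (SP) holds for every
matching code** — the bottom step of (NC) for every sparse paving matroid of corank `2` in gen 29 §8's dictionary (paper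
only).  The coupling is EXPLICIT (type-symmetric): with
`r = #Y / #P`, the weight of the pair `(X, X ∪ y)` is `1/2` if `X ∪ y` is touched (`y` the partner of a matched point of
`X`), `a(k)` if `y` is matched and untouched, `b(k)` if `y` is unmatched, where
`b 0 = a 2 = 1/3`, `a 0 = (r − (u−2)/3)/(2m)`, `b 2 = (r − (2m−1)/3)/u`, `b 1 = (1 − a 0)/2`, `a 1 = (1 − b 2)/2`
(`a 0 := 0` when `m = 0`, `b 2 := 0` when `u = 0`).  Column sums: a touched triple has exactly two `P`-subsets, each of
weight `1/2`; an untouched triple with `k` matched points has column sum `k·a(k−1) + (3−k)·b(k) = 1`.  Row sums: a pair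
with `k` matched points has `k` touched supersets, `2m − 2k` untouched supersets with a matched point and `u − 2 + k` with
an unmatched point, so its row sum is `k/2 + (2m−2k)·a(k) + (u−2+k)·b(k) = r` — for `k = 1` this is the cubic identity
`n(n−1)(n−2) = 6mu(n−2) + u(u−1)(u−2) + 4m(m−1)(2m−1)`, `n = u + 2m`.  Nonnegativity is four elementary inequalities.
The master lemma `card_upNbhd_ge_of_weights` then gives (SP).  Nothing here asserts (SP) for `j ≥ 3`.
-/

namespace PercRepro.PuncturedLYM

open Finset

variable {α : Type} [Fintype α] [DecidableEq α]

/-! ### Matched points -/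

/-- The matched points: the union of the pairs of `D`. -/
def matchedPts (D : Finset (Finset α)) : Finset α := D.biUnion id

omit [Fintype α] in
/-- A matching: a code of `2`-sets. Two distinct members are disjoint. -/
theorem disjoint_of_isCode_two {D : Finset (Finset α)} (hD : IsCode 2 D) {B B' : Finset α} (hB : B ∈ D) (hB' : B' ∈ D)
    (hne : B ≠ B') : Disjoint B B' := by
  have h := hD.2 B hB B' hB' hne
  rw [disjoint_iff_inter_eq_empty, ← card_eq_zero]
  omega

omit [Fintype α] in
/-- `#M = 2m`. -/
theorem card_matchedPts {D : Finset (Finset α)} (hD : IsCode 2 D) : (matchedPts D).card = 2 * D.card := by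
  unfold matchedPts
  rw [card_biUnion]
  · simp only [id]
    rw [sum_congr rfl (fun B hB => hD.1 B hB), sum_const, smul_eq_mul, mul_comm]
  · intro B hB B' hB' hne
    exact disjoint_of_isCode_two hD hB hB' hne

omit [Fintype α] in
/-- A point lies in at most one pair: the pair through `x` is unique. -/
theorem pair_unique {D : Finset (Finset α)} (hD : IsCode 2 D) {B B' : Finset α} (hB : B ∈ D) (hB' : B' ∈ D) {x : α}
    (hx : x ∈ B) (hx' : x ∈ B') : B = B' := by
  by_contra hne
  have := disjoint_of_isCode_two hD hB hB' hne
  exact (disjoint_left.1 this) hx hx'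

omit [Fintype α] in
/-- Membership in the matched points. -/
theorem mem_matchedPts {D : Finset (Finset α)} {x : α} : x ∈ matchedPts D ↔ ∃ B ∈ D, x ∈ B := by
  simp [matchedPts]

/-- The number of matched points of `X`. -/
def kOf (D : Finset (Finset α)) (X : Finset α) : ℕ := (X ∩ matchedPts D).card

omit [Fintype α] in
/-- A point outside `M` does not complete a code word: `insert y X` is untouched when `y ∉ M` and `X ∈ P`. -/
theorem not_touched_of_not_mem_matchedPts {D : Finset (Finset α)} (hD : IsCode 2 D) {X : Finset α}
    (hX : X.card = 2 ∧ X ∉ D) {y : α} (hy : y ∉ matchedPts D) : ¬ Touched D (insert y X) := by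
  rintro ⟨B, hB, hBY⟩
  have hBc := hD.1 B hB
  by_cases hyB : y ∈ B
  · exact hy (mem_matchedPts.2 ⟨B, hB, hyB⟩)
  · have hBX : B ⊆ X := by
      intro z hz
      have := hBY hz
      rw [mem_insert] at this
      rcases this with rfl | h
      · exact absurd hz hyB
      · exact h
    have : B = X := eq_of_subset_of_card_le hBX (by omega)
    exact hX.2 (this ▸ hB)

/-- The code neighbours of a pair `X ∈ P` are the pairs through its matched points: `#codeNbrs(X) = k(X)`. -/
theorem card_codeNbrs_two {D : Finset (Finset α)} (hD : IsCode 2 D) {X : Finset α} (hX : X ∈ punctured 2 D) :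
    (codeNbrs 2 D X).card = kOf D X := by
  obtain ⟨hXc, hXD⟩ := mem_punctured.1 hX
  -- `Σ_{B ∈ D} [#(B ∩ X) = 1] = Σ_{B ∈ D} #(B ∩ X) = Σ_{B ∈ D} Σ_{x ∈ X} [x ∈ B] = Σ_{x ∈ X} [x ∈ M]`
  have h1 : ∀ B ∈ D, (if (B ∩ X).card + 1 = 2 then 1 else 0) = (B ∩ X).card := by
    intro B hB
    have hBc := hD.1 B hB
    have hne : B ≠ X := fun h => hXD (h ▸ hB)
    have hle : (B ∩ X).card ≤ 1 := by
      by_contra h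
      have h2 : B ∩ X = B := eq_of_subset_of_card_le inter_subset_left (by omega)
      have h3 : B ⊆ X := h2 ▸ inter_subset_right
      exact hne (eq_of_subset_of_card_le h3 (by omega))
    split_ifs with h
    · omega
    · omega
  have h2 : ∀ B ∈ D, (B ∩ X).card = ∑ x ∈ X, if x ∈ B then 1 else 0 := by
    intro B _
    rw [← card_filter, inter_comm]
    rfl
  have h3 : ∀ x ∈ X, (∑ B ∈ D, if x ∈ B then 1 else 0) = if x ∈ matchedPts D then 1 else 0 := by
    intro x _
    rw [← card_filter]
    split_ifs with hx
    · obtain ⟨B, hB, hxB⟩ := mem_matchedPts.1 hx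
      rw [card_eq_one]
      refine ⟨B, ?_⟩
      ext B'
      simp only [mem_filter, mem_singleton]
      constructor
      · rintro ⟨hB', hxB'⟩
        exact pair_unique hD hB' hB hxB' hxB
      · rintro rfl
        exact ⟨hB, hxB⟩
    · rw [card_eq_zero, filter_eq_empty_iff]
      intro B hB hxB
      exact hx (mem_matchedPts.2 ⟨B, hB, hxB⟩)
  unfold codeNbrs kOf
  rw [card_filter, sum_congr rfl h1, sum_congr rfl h2, sum_comm, sum_congr rfl h3, ← card_filter, filter_mem_eq_inter]

/-- The touched supersets of a pair `X ∈ P` are counted by its matched points: `t(X) = k(X)`. -/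
theorem touchedCount_two {D : Finset (Finset α)} (hD : IsCode 2 D) {X : Finset α} (hX : X ∈ punctured 2 D) :
    touchedCount D X = kOf D X := by
  rw [touchedCount_eq_card_codeNbrs hD hX, card_codeNbrs_two hD hX]

omit [Fintype α] in
/-- `k(X) ≤ #X`. -/
theorem kOf_le (D : Finset (Finset α)) (X : Finset α) : kOf D X ≤ X.card :=
  card_le_card inter_subset_left

omit [Fintype α] in
/-- `#(X ∪ M) = #X + 2m − k(X)`. -/
theorem card_union_matchedPts {D : Finset (Finset α)} (hD : IsCode 2 D) (X : Finset α) :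
    (X ∪ matchedPts D).card + kOf D X = X.card + 2 * D.card := by
  rw [← card_matchedPts hD]
  unfold kOf
  exact card_union_add_card_inter X (matchedPts D)

/-! ### The cardinalities of `P` and `Y` for `j = 2`, and the ratio `r` -/

omit [DecidableEq α] in
/-- `#Y = C(n, 3)`. -/
theorem card_levelAbove_two : (levelAbove α 2).card = (Fintype.card α).choose 3 := by
  unfold levelAbove
  rw [card_powersetCard, card_univ]

/-- `#P = C(n, 2) − m`. -/
theorem card_punctured_two {D : Finset (Finset α)} (hD : IsCode 2 D) :
    (punctured 2 D).card + D.card = (Fintype.card α).choose 2 := by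
  unfold punctured
  rw [card_sdiff_add_card_eq_card, card_powersetCard, card_univ]
  intro B hB
  rw [mem_powersetCard]
  exact ⟨subset_univ B, hD.1 B hB⟩

/-- The ratio `r = #Y / #P`. -/
def rr (α : Type) [Fintype α] [DecidableEq α] (D : Finset (Finset α)) : ℚ :=
  ((levelAbove α 2).card : ℚ) / (punctured 2 D).card

/-- `6 · C(n,3) = n(n−1)(n−2)` and `2 · C(n,2) = n(n−1)` in `ℚ` (for `n ≥ 2`). -/
theorem choose_two_three_cast {n : ℕ} (hn : 2 ≤ n) :
    ((n.choose 2 : ℕ) : ℚ) * 2 = n * (n - 1) ∧ ((n.choose 3 : ℕ) : ℚ) * 3 = (n.choose 2 : ℕ) * (n - 2) := by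
  have h1 := Nat.choose_succ_right_eq n 1
  have h2 := Nat.choose_succ_right_eq n 2
  rw [Nat.choose_one_right] at h1
  constructor
  · have : ((n.choose 2 * 2 : ℕ) : ℚ) = ((n * (n - 1) : ℕ) : ℚ) := by rw [h1]
    push_cast [Nat.cast_sub (by omega : 1 ≤ n)] at this
    linarith
  · have : ((n.choose 3 * 3 : ℕ) : ℚ) = ((n.choose 2 * (n - 2) : ℕ) : ℚ) := by rw [h2]
    push_cast [Nat.cast_sub hn] at this
    linarith

/-- The closed form of `r`: `r · 3 (n(n−1) − 2m) = n(n−1)(n−2)` (when `P ≠ ∅`). -/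
theorem rr_mul {D : Finset (Finset α)} (hD : IsCode 2 D) (hn : 2 ≤ Fintype.card α) (hP : 0 < (punctured 2 D).card) :
    rr α D * (3 * ((Fintype.card α : ℚ) * (Fintype.card α - 1) - 2 * D.card)) =
      (Fintype.card α : ℚ) * (Fintype.card α - 1) * (Fintype.card α - 2) := by
  obtain ⟨h2, h3⟩ := choose_two_three_cast hn
  have hPc := card_punctured_two hD
  have hPq : ((punctured 2 D).card : ℚ) + D.card = ((Fintype.card α).choose 2 : ℕ) := by exact_mod_cast hPc
  have hPq0 : ((punctured 2 D).card : ℚ) ≠ 0 := by exact_mod_cast hP.ne'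
  have key : 3 * ((Fintype.card α : ℚ) * (Fintype.card α - 1) - 2 * D.card) = 6 * (punctured 2 D).card := by
    linear_combination (-3 : ℚ) * h2 - 6 * hPq
  unfold rr
  rw [card_levelAbove_two, key]
  calc ((Fintype.card α).choose 3 : ℕ) / ((punctured 2 D).card : ℚ) * (6 * (punctured 2 D).card)
      = 6 * ((Fintype.card α).choose 3 : ℕ) := by field_simp
    _ = (Fintype.card α : ℚ) * (Fintype.card α - 1) * (Fintype.card α - 2) := by
      linear_combination (2 : ℚ) * h3 + ((Fintype.card α : ℚ) - 2) * h2

/-! ### The weights -/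

/-- `u = n − 2m` as a rational. -/
def uQ (α : Type) [Fintype α] (D : Finset (Finset α)) : ℚ := (Fintype.card α : ℚ) - 2 * D.card

/-- `a 0 = (r − (u−2)/3) / (2m)` (`0` when `m = 0`). -/
def a0 (α : Type) [Fintype α] [DecidableEq α] (D : Finset (Finset α)) : ℚ :=
  if D.card = 0 then 0 else (rr α D - (uQ α D - 2) / 3) / (2 * D.card)

/-- `b 2 = (r − (2m−1)/3) / u` (`0` when `u = 0`). -/
def b2 (α : Type) [Fintype α] [DecidableEq α] (D : Finset (Finset α)) : ℚ :=
  if uQ α D = 0 then 0 else (rr α D - (2 * D.card - 1) / 3) / uQ α D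

/-- The untouched weights for a matched completing point, by the number `k` of matched points of `X`. -/
def aW (α : Type) [Fintype α] [DecidableEq α] (D : Finset (Finset α)) : ℕ → ℚ
  | 0 => a0 α D
  | 1 => (1 - b2 α D) / 2
  | _ => 1 / 3

/-- The untouched weights for an unmatched completing point. -/
def bW (α : Type) [Fintype α] [DecidableEq α] (D : Finset (Finset α)) : ℕ → ℚ
  | 0 => 1 / 3
  | 1 => (1 - a0 α D) / 2
  | _ => b2 α D

/-- The weight of the completion `X ↦ insert y X`: `1/2` when touched, else `a k` / `b k` by the type of `y`. -/
def omW (α : Type) [Fintype α] [DecidableEq α] (D : Finset (Finset α)) (X : Finset α) (y : α) : ℚ :=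
  if Touched D (insert y X) then 1 / 2 else if y ∈ matchedPts D then aW α D (kOf D X) else bW α D (kOf D X)

/-- The matching weights on a pair `(X, Y)`: `ω` at the point of `Y ∖ X`. -/
def mW (α : Type) [Fintype α] [DecidableEq α] (D : Finset (Finset α)) (X Y : Finset α) : ℚ :=
  ∑ y ∈ Y \ X, omW α D X y

/-- `mW X (insert y X) = ω X y` for `y ∉ X`. -/
theorem mW_insert (D : Finset (Finset α)) (X : Finset α) {y : α} (hy : y ∉ X) : mW α D X (insert y X) = omW α D X y := by
  unfold mW
  have h : insert y X \ X = {y} := by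
    ext z
    simp only [mem_sdiff, mem_insert, mem_singleton]
    constructor
    · rintro ⟨h1, h2⟩
      exact h1.resolve_right h2
    · rintro rfl
      exact ⟨Or.inl rfl, hy⟩
  rw [h, sum_singleton]

/-! ### Row sums -/

/-- `2m ≤ n` and `k(X) ≤ 2m`. -/
theorem two_mul_card_le {D : Finset (Finset α)} (hD : IsCode 2 D) : 2 * D.card ≤ Fintype.card α := by
  rw [← card_matchedPts hD]
  exact card_le_univ _

omit [Fintype α] in
/-- `k(X) ≤ 2m`. -/
theorem kOf_le_two_mul {D : Finset (Finset α)} (hD : IsCode 2 D) (X : Finset α) : kOf D X ≤ 2 * D.card := by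
  unfold kOf
  rw [← card_matchedPts hD]
  exact card_le_card inter_subset_right

/-- **The row sum at a pair `X ∈ P` with `k` matched points**: `k/2 + (2m − 2k)·a(k) + (n − 2m − 2 + k)·b(k)` — the
completing points split into `k` touched (the partners), `2m − 2k` matched untouched and `n − 2m − 2 + k` unmatched. -/
theorem sum_sups_mW {D : Finset (Finset α)} (hD : IsCode 2 D) {X : Finset α} (hX : X ∈ punctured 2 D) :
    ∑ Y ∈ sups 2 X, mW α D X Y =
      (kOf D X : ℚ) / 2 + (2 * D.card - 2 * kOf D X : ℚ) * aW α D (kOf D X)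
        + ((Fintype.card α : ℚ) - 2 * D.card - 2 + kOf D X) * bW α D (kOf D X) := by
  obtain ⟨hXc, hXD⟩ := mem_punctured.1 hX
  rw [sum_sups hXc]
  have h1 : ∀ y ∈ univ \ X, mW α D X (insert y X) = omW α D X y :=
    fun y hy => mW_insert D X (mem_sdiff.1 hy).2
  rw [sum_congr rfl h1]
  unfold omW
  rw [sum_ite, sum_const, sum_ite, sum_const, sum_const, nsmul_eq_mul, nsmul_eq_mul, nsmul_eq_mul]
  have hk : kOf D X ≤ 2 := hXc ▸ kOf_le D X
  have hM : 2 * D.card ≤ Fintype.card α := two_mul_card_le hD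
  have hk2 : kOf D X ≤ 2 * D.card := kOf_le_two_mul hD X
  have hXM := card_union_matchedPts hD X
  rw [hXc] at hXM
  have hXMn : (X ∪ matchedPts D).card ≤ Fintype.card α := card_le_univ _
  have hc1 : ((univ \ X).filter (fun y => Touched D (insert y X))).card = kOf D X := touchedCount_two hD hX
  have hc3 : (((univ \ X).filter (fun y => ¬ Touched D (insert y X))).filter (fun y => ¬ y ∈ matchedPts D)).card
      = (X ∪ matchedPts D).card - (2 * D.card - kOf D X) + (2 * D.card - kOf D X) - (2 + 2 * D.card - kOf D X)
        + (Fintype.card α - (X ∪ matchedPts D).card) := by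
    have heq : ((univ \ X).filter (fun y => ¬ Touched D (insert y X))).filter (fun y => ¬ y ∈ matchedPts D)
        = univ \ (X ∪ matchedPts D) := by
      ext y
      simp only [mem_filter, mem_sdiff, mem_univ, true_and, mem_union, not_or]
      constructor
      · rintro ⟨⟨hyX, -⟩, hyM⟩
        exact ⟨hyX, hyM⟩
      · rintro ⟨hyX, hyM⟩
        exact ⟨⟨hyX, not_touched_of_not_mem_matchedPts hD ⟨hXc, hXD⟩ hyM⟩, hyM⟩
    rw [heq, card_univ_sdiff]
    omega
  have hsplit := card_filter_add_card_filter_not (fun y => y ∈ matchedPts D)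
    (s := (univ \ X).filter (fun y => ¬ Touched D (insert y X)))
  have htot := card_filter_add_card_filter_not (fun y => Touched D (insert y X)) (s := univ \ X)
  rw [card_univ_sdiff, hXc] at htot
  have hc2 : (((univ \ X).filter (fun y => ¬ Touched D (insert y X))).filter (fun y => y ∈ matchedPts D)).card
      = 2 * D.card - 2 * kOf D X := by
    omega
  have hc3' : (((univ \ X).filter (fun y => ¬ Touched D (insert y X))).filter (fun y => ¬ y ∈ matchedPts D)).card
      = Fintype.card α - (2 + 2 * D.card - kOf D X) := by
    omega
  rw [hc1, hc2, hc3']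
  have e1 : ((2 * D.card - 2 * kOf D X : ℕ) : ℚ) = 2 * D.card - 2 * kOf D X := by
    rw [Nat.cast_sub (by omega)]
    push_cast
    ring
  have e2 : ((Fintype.card α - (2 + 2 * D.card - kOf D X) : ℕ) : ℚ) = (Fintype.card α : ℚ) - 2 * D.card - 2 + kOf D X := by
    rw [Nat.cast_sub (by omega), Nat.cast_sub (by omega)]
    push_cast
    ring
  rw [e1, e2]
  ring

end PercRepro.PuncturedLYM
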